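import Literature.Algebra.Polynomial.CasasAlvero.CharElevenComplete
import Literature.Algebra.Polynomial.CasasAlvero.Degree8CharPMore
import Literature.Algebra.Polynomial.CasasAlvero.Degree10CharP
import HarnessLib

/-!
# Casas-Alvero degrees in characteristic 13: everything except the digits `5` and `11`

By the digit criterion a Casas-Alvero degree in characteristic `13` is `0` or `a·13^k` with `1 ≤ a ≤ 12`.  Decided here:
`a = 1, 2, 3, 4` are Casas-Alvero digits ([GrafVonBothmerEtAl2007, Props. 2, 6]; de Jong–Draisma for `a = 4`), and
`a = 6, 7, 8, 9, 10, 12` are not (`6`, `7`: the prime-field counterexample tables of this directory; `8`: `Degree8CharP.lean`;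
`9`: `Degree9CharP.lean`; `10`: `Degree10CharP.lean`; `12`: the binomial `X^12 - X^2`, `binom(12,2) = 66 ≡ 1 (mod 13)`).  Left undecided:
`a = 5` (true according to the bad-prime computation of [CastryckLaterveerOunaies2012, §2], not formalised) and `a = 11`.
-/

noncomputable section

open Polynomial

namespace Literature.Algebra.Polynomial.CasasAlvero

variable (K : Type*) [Field K] [CharP K 13]

/-- `CA_{4·13^k}` over every field of characteristic `13`. [cite: GrafVonBothmerEtAl2007, Prop. 6] -/
theorem holdsInDegree_four_mul_thirteen_pow (k : ℕ) : HoldsInDegree K (4 * 13 ^ k) := by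
  haveI : Fact (Nat.Prime 13) := ⟨by norm_num⟩
  exact holdsInDegree_mul_prime_pow_field K 13
    (holdsInDegree_of_le_four_of_charP (AlgebraicClosure K) 13 (by norm_num) le_rfl) k

/-- `¬ CA_12` in characteristic `13`: `X^12 - X^2`, `binom(12,2) = 66 ≡ 1 (mod 13)`. [folklore] -/
theorem not_holdsInDegree_twelve_of_char_thirteen : ¬ HoldsInDegree K 12 :=
  not_holdsInDegree_of_choose_modEq_one K 13 (m := 2) (by norm_num) (by norm_num) (by decide)

/-- **characteristic 13**: the Casas-Alvero degrees are among `{0} ∪ {1,2,3,4,5,11}·13^k`, and `{0} ∪ {1,2,3,4}·13^k`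
are Casas-Alvero degrees; the digits `5, 11` are undecided here. [cite: GrafVonBothmerEtAl2007, Props. 2, 6, 7]
[cite: CastryckLaterveerOunaies2012, §2] -/
theorem classification_char_thirteen (d : ℕ) :
    (HoldsInDegree K d → d = 0 ∨ ∃ k, d = 13 ^ k ∨ d = 2 * 13 ^ k ∨ d = 3 * 13 ^ k ∨ d = 4 * 13 ^ k ∨
      d = 5 * 13 ^ k ∨ d = 11 * 13 ^ k) ∧
    (d = 0 ∨ (∃ k, d = 13 ^ k ∨ d = 2 * 13 ^ k ∨ d = 3 * 13 ^ k ∨ d = 4 * 13 ^ k) → HoldsInDegree K d) := by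
  haveI : Fact (Nat.Prime 13) := ⟨by norm_num⟩
  refine ⟨fun h => ?_, ?_⟩
  · by_contra hne
    push Not at hne
    obtain ⟨hd0, hne⟩ := hne
    by_cases h6 : ∃ k, d = 6 * 13 ^ k
    · obtain ⟨k, rfl⟩ := h6
      exact not_holdsInDegree_six_mul_prime_pow K 13 (by norm_num) k h
    by_cases h7 : ∃ k, d = 7 * 13 ^ k
    · obtain ⟨k, rfl⟩ := h7
      exact not_holdsInDegree_seven_mul_prime_pow K 13 (by norm_num) (by norm_num) k h
    by_cases h8 : ∃ k, d = 8 * 13 ^ k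
    · obtain ⟨k, rfl⟩ := h8
      exact not_holdsInDegree_mul_prime_pow 13 k (not_holdsInDegree_eight_of_char_13 K) h
    by_cases h9 : ∃ k, d = 9 * 13 ^ k
    · obtain ⟨k, rfl⟩ := h9
      exact not_holdsInDegree_mul_prime_pow 13 k (not_holdsInDegree_nine_of_char_13 K) h
    by_cases h10 : ∃ k, d = 10 * 13 ^ k
    · obtain ⟨k, rfl⟩ := h10
      exact not_holdsInDegree_mul_prime_pow 13 k (not_holdsInDegree_ten_of_char_13 K) h
    by_cases h12 : ∃ k, d = 12 * 13 ^ k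
    · obtain ⟨k, rfl⟩ := h12
      exact not_holdsInDegree_mul_prime_pow 13 k (not_holdsInDegree_twelve_of_char_thirteen K) h
    push Not at h6 h7 h8 h9 h10 h12
    refine not_holdsInDegree_of_not_digit K 13 hd0 (fun k a ha => ?_) h
    obtain ⟨h1, h2, h3, h4, h5, h11⟩ := hne k
    interval_cases a
    · simpa using hd0
    · simpa using h1
    · exact h2
    · exact h3
    · exact h4
    · exact h5
    · exact h6 k
    · exact h7 k
    · exact h8 k
    · exact h9 k
    · exact h10 k
    · exact h11
    · exact h12 k
  · rintro (rfl | ⟨k, rfl | rfl | rfl | rfl⟩)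
    · exact holdsInDegree_zero K
    · exact holdsInDegree_prime_pow_field K 13 k
    · exact holdsInDegree_two_mul_prime_pow_field K 13 k
    · exact holdsInDegree_three_mul_prime_pow_field K 13 (by norm_num) k
    · exact holdsInDegree_four_mul_thirteen_pow K k

end Literature.Algebra.Polynomial.CasasAlvero
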